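import Literature.NumberTheory.Automorphic.InfinityTypeAutomorphicInduction
import Literature.NumberTheory.Automorphic.HenniartAutomorphicInduction
import HarnessLib

/-!
# L-algebraicity descends through a cyclic automorphic induction
# (crux `AscentConjugationSolvable`, stmt-Langlands-1094; piece `CyclicPrimeAscent`; lead c3 helper stub H5)

Support file (closes nothing).  Let `L/K` be a Galois extension of number fields with cyclic
Galois group, of degree `d`, `n ≥ 1`, `P` a cuspidal automorphic representation of
`GL_{dn}(𝔸_K)` automorphically induced (`IsAutomorphicInductionAlong`, Arthur–Clozel Def. 6.1)
from a cuspidal `π` on `GL_n(𝔸_L)`.  If `P` is L-algebraic then so is `π` — granted, as explicit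
hypotheses, Henniart's archimedean clause `Henniart2012_infinityType_of_automorphicInduction`
(Henniart 2012, Thm. 5 and Remarque §3.7: the `z`-exponents of an infinity type `T_P` of `P` at
`σ : K → ℂ` are the union of those of an infinity type `T_π` of `π` at the `σ' ∣ σ`) and Clozel's
existence of infinity types `AutomorphicRepData.exists_hasInfinityType` (Clozel 1990, §3.3).

Proof (the pattern of `ArthurClozel1989_strongLifting_archimedean.isLAlgebraic_descent`): pick
infinity types `T_π` of `π` (existence) and `T_P` of `P` with integral exponents
(L-algebraicity of `P`).  For `p ∈ T_π σ'`, the exponent `p.a` lies in the summand at `σ'` of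
`∑_{σ'' ∣ σ} (T_π σ'').map a = (T_P σ).map a`, `σ = σ'|_K` (Henniart), so `p.a = q.a ∈ ℤ` for
some `q ∈ T_P σ`; and `p.b = (p.swap).a` with `p.swap ∈ T_π σ̄'` (well-formedness of `T_π`), an
integer by the same argument at `σ̄'`.

References: G. Henniart, *Induction automorphe globale pour les corps de nombres*, Bull. SMF 140
(2012), Thm. 5 and Remarque §3.7; K. Buzzard, T. Gee, *The conjectural connections between
automorphic representations and Galois representations* (2014), Def. 3.1.1; L. Clozel, *Motifs et
formes automorphes* (1990), §3.3.
-/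

noncomputable section

set_option linter.dupNamespace false -- project-wide option; `Summit.Langlands.Langlands` is the mandated namespace

namespace Summit.Langlands.Langlands.Theorems.SmithKummerSeedCyclicPrimeAscent

open scoped MatrixGroups NumberField Classical Matrix Polynomial
open Filter IsDedekindDomain Field
open Literature.NumberTheory.Automorphic

/-- **L-algebraicity descends through a cyclic automorphic induction** (Henniart 2012, Thm. 5 and
Remarque §3.7, read on infinity types; Buzzard–Gee 2014, Def. 3.1.1): for `L/K` Galois with cyclic
group, of degree `d`, `n ≥ 1`, `P` cuspidal on `GL_{dn}(𝔸_K)` automorphically induced from the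
cuspidal `π` on `GL_n(𝔸_L)`, if `P` is L-algebraic then so is `π` — granted Henniart's archimedean
clause and Clozel's existence of infinity types (both explicit hypotheses).  The `a`-exponents of
an infinity type of `π` at `σ'` are among those of an (integral) infinity type of `P` at `σ'|_K`;
the `b`-exponents are `a`-exponents at `σ̄'` by well-formedness.
[cite: Henniart2012, Thm. 5 and Remarque §3.7] [cite: BuzzardGee2014, Def. 3.1.1] -/
theorem isLAlgebraic_of_isAutomorphicInductionAlong : Literature.NumberTheory.Automorphic.Henniart2012_infinityType_of_automorphicInduction → (∀ (n : ℕ) (K : Type) [Field K] [NumberField K] (hK : Literature.NumberTheory.Automorphic.isCompact_glFiniteIntegralLevel n K) (π : Literature.NumberTheory.Automorphic.AutomorphicRepData (Literature.NumberTheory.Automorphic.AutomorphyDatum.gl n K hK)), π.exists_hasInfinityType) → ∀ (K L : Type) [Field K] [NumberField K] [Field L] [NumberField L] [Algebra K L] [IsGalois K L], IsCyclic (L ≃ₐ[K] L) → ∀ (n d : ℕ), 0 < n → Module.finrank K L = d → ∀ (hK : Literature.NumberTheory.Automorphic.isCompact_glFiniteIntegralLevel (d * n) K) (hL : Literature.NumberTheory.Automorphic.isCompact_glFiniteIntegralLevel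 n L) (P : Literature.NumberTheory.Automorphic.CuspidalAutomorphicRepData (d * n) K hK) (π : Literature.NumberTheory.Automorphic.CuspidalAutomorphicRepData n L hL), Literature.NumberTheory.Automorphic.IsAutomorphicInductionAlong π.1 P.1 → P.1.IsLAlgebraic → π.1.IsLAlgebraic := by
  intro h hinf K L _ _ _ _ _ _ hcyc n d hn hd hK hL P π hAI hP
  obtain ⟨Tπ, hTπ⟩ := hinf n L hL π.1
  obtain ⟨TP, hTP, hLP⟩ := hP
  refine ⟨Tπ, hTπ, ?_⟩
  -- Henniart: the `a`-exponents of `TP` at `σ` are those of `Tπ` at the `σ' ∣ σ`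
  have hH : ∀ σ : K →+* ℂ, (TP σ).map ArchWeight.a =
      ∑ σ' ∈ Finset.univ.filter (fun σ' : L →+* ℂ => σ'.comp (algebraMap K L) = σ),
        (Tπ σ').map ArchWeight.a := fun σ =>
    Henniart2012_infinityType_of_automorphicInduction_iff_along.mp h K L hcyc n d hn hd hK hL P π
      hAI TP Tπ hTP hTπ σ
  -- integrality of the `a`-exponents of `Tπ` at every `σ'`
  have ha : ∀ σ' : L →+* ℂ, ∀ p ∈ Tπ σ', ∃ k : ℤ, p.a = k := by
    intro σ' p hp
    have hle : (Tπ σ').map ArchWeight.a ≤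
        ∑ σ'' ∈ Finset.univ.filter
          (fun σ'' : L →+* ℂ => σ''.comp (algebraMap K L) = σ'.comp (algebraMap K L)),
          (Tπ σ'').map ArchWeight.a :=
      Finset.single_le_sum (f := fun σ'' : L →+* ℂ => (Tπ σ'').map ArchWeight.a)
        (fun _ _ => Multiset.zero_le _) (Finset.mem_filter.mpr ⟨Finset.mem_univ _, rfl⟩)
    have hmem : p.a ∈ (TP (σ'.comp (algebraMap K L))).map ArchWeight.a := by
      rw [hH]
      exact Multiset.mem_of_le hle (Multiset.mem_map_of_mem _ hp)
    obtain ⟨q, hq, hqa⟩ := Multiset.mem_map.mp hmem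
    obtain ⟨k, l, hk, -⟩ := hLP _ q hq
    exact ⟨k, by rw [← hqa, hk]⟩
  intro σ' p hp
  obtain ⟨k, hk⟩ := ha σ' p hp
  -- the `b`-exponent of `p` at `σ'` is an `a`-exponent at `σ̄'`
  have hswap : p.swap ∈ Tπ (NumberField.ComplexEmbedding.conjugate σ') := by
    rw [hTπ.1.2 σ']
    exact Multiset.mem_map_of_mem _ hp
  obtain ⟨l, hl⟩ := ha _ _ hswap
  exact ⟨k, l, hk, by simpa using hl⟩

end Summit.Langlands.Langlands.Theorems.SmithKummerSeedCyclicPrimeAscent
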